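/-
Copyright (c) 2026 the pub-hodgecm-mathlib formalisation cell (harness21).  Prover seat hodgecm-mathlib-K2E4-p11 (g8): Track B «K2-LIT»,
#184♮ = hLiu418 = stmt-HodgeConjecture-24832; socket #42S road (T-S5) §A-(U), split out of LH4-p17 (g2)'s head file (LEAD F0P6-plan (g14) BATCH #144 (1)):
a standard section family is determined by its values on `𝒦.K` at ONE parameter.  THEOREMS ONLY (no `def`, no `instance`, no `notation`, no named-fact hypothesis, no `sorry`).
-/
import Literature.NumberTheory.K2Lit.SiegelStandardSections      -- ★ `IwasawaDatum` (Iwasawa decomposition), `IsStandardSectionFamily` (section law + flatness on `K`)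
import HarnessLib

/-!
# Crux `HLiu418`, socket #42S, (T-S5) §A-(U) — `K2LiuStandardFamilyDeterminedAtPoint`: A STANDARD FAMILY IS DETERMINED BY ITS RESTRICTION TO `K` AT ONE POINT

Cell `hodgecm-mathlib`, crux item hLiu418 = `stmt-HodgeConjecture-24832`; squad K2 ∕ K2Liu (L1, LEAD F0P6-plan (g14)), road `K2_Liu`, socket #42S, road (T-S5); consumer =
LH4-p17 (g2)'s (T-S5) head file ((b)-transport + §C), imported by name.  Lane `--supports stmt-HodgeConjecture-24832 --as helper` (count-neutral helper; closes no socket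
by itself).  General frame `e : Fin N × Fin M ≃ Fin n`.

THE MATHEMATICS [Tan1999, §1 p. 166], [KudlaRallis1994, §1 (1.12)–(1.14)], [MoeglinWaldspurger1995, I.2.17].  A STANDARD family `f` for the Iwasawa datum `𝒦` is a family of
Siegel sections (`f_s(p·h) = δ_s^χ(p)·f_s(h)` for `p ∈ P_Δ(𝔸)`) whose restriction to `K = 𝒦.K` does not depend on `s`.  By the Iwasawa decomposition `H(𝔸) = P_Δ(𝔸)·K` (a FIELD
of `IwasawaDatum`), `f_s(h) = f_s(p·k) = δ_s^χ(p)·f_s(k) = δ_s^χ(p)·f_{s₀}(k)`: so two standard families that agree on `K` at one `s₀` agree everywhere (§1), and a standard family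
vanishing on `K` at one `s₀` vanishes identically (§1, corollary).  `𝒦.IsStd` is NOT needed (only the decomposition), so the heads do not take it.
* §1 **`eq_of_isStandardSectionFamily_of_eq_at`**, `eq_zero_of_isStandardSectionFamily_of_eq_zero_at`, and the one-parameter restatement `funext`-free
  `isStandardSectionFamily_ext_iff`.
HONEST LABEL.  Count-neutral helper; it retires nothing by itself: `HC_CM` is proved only modulo the 7 printed citations (2 remaining named inputs:
hLiu418 = `stmt-HodgeConjecture-24832`, h413 = `stmt-HodgeConjecture-24833`) until rung 0 closes.

## References
* [Tan1999] V. Tan, *Poles of Siegel Eisenstein series on U(n,n)*, Canad. J. Math. 51 (1999), §1 p. 166 (standard sections).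
* [KudlaRallis1994] S. Kudla, S. Rallis, Ann. of Math. 140 (1994), §1 (1.12)–(1.14).
* [MoeglinWaldspurger1995] C. Mœglin, J.-L. Waldspurger, *Spectral decomposition and Eisenstein series* (1995), I.2.17.
-/

set_option autoImplicit false
set_option linter.dupNamespace false -- the mandated namespace repeats `HodgeConjecture.HodgeConjecture`

noncomputable section

open NumberField
open Literature.NumberTheory.Automorphic Literature.NumberTheory.GaloisRepresentations
open Literature.NumberTheory.GelbartRogawski1991 Literature.NumberTheory.GelbartRogawski1991.GRConstruction
open Literature.NumberTheory.K2Lit.SiegelDoubled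

namespace Summit.HodgeConjecture.HodgeConjecture.Cruxes.HLiu418.K2LiuStandardFamilyDeterminedAtPoint

variable {L : Type} [Field L] [NumberField L] [IsCMField L]
variable {N M n : ℕ} {e : Fin N × Fin M ≃ Fin n}
  {dV : Fin N → L} {hdV : ∀ i, IsCMField.complexConj L (dV i) = dV i}
  {dW : Fin M → L} {hdW : ∀ i, IsCMField.complexConj L (dW i) = dW i}

/-! ## §1 Determination by the restriction to `K` at one parameter -/

/-- **A STANDARD FAMILY IS DETERMINED BY ITS VALUES ON `K` AT ONE PARAMETER.**  If `f`, `g` are standard section families for the Iwasawa datum `𝒦` (same character `χ`) and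
`f_{s₀} = g_{s₀}` on `𝒦.K` for ONE `s₀`, then `f = g`: Iwasawa `h = p·k`, section law, flatness on `K`. [cite: Tan1999, §1 p. 166] [cite: KudlaRallis1994, §1 (1.12)–(1.14)] -/
theorem eq_of_isStandardSectionFamily_of_eq_at (𝒦 : IwasawaDatum L e dV hdV dW hdW) {χ : HeckeCharacter L}
    {f g : ℂ → HA L e dV hdV dW hdW → ℂ} (hf : IsStandardSectionFamily 𝒦 χ f) (hg : IsStandardSectionFamily 𝒦 χ g)
    {s₀ : ℂ} (h : ∀ k ∈ 𝒦.K, f s₀ k = g s₀ k) : ∀ (s : ℂ) (x : HA L e dV hdV dW hdW), f s x = g s x := by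
  intro s x
  obtain ⟨p, k, hp, hk, rfl⟩ := 𝒦.iwasawa x
  rw [hf.1.1 s p hp k, hg.1.1 s p hp k, hf.2.2 k hk s s₀, hg.2.2 k hk s s₀, h k hk]

/-- **Corollary — VANISHING**: a standard family that vanishes on `𝒦.K` at one parameter vanishes identically. [cite: Tan1999, §1 p. 166] -/
theorem eq_zero_of_isStandardSectionFamily_of_eq_zero_at (𝒦 : IwasawaDatum L e dV hdV dW hdW) {χ : HeckeCharacter L}
    {f : ℂ → HA L e dV hdV dW hdW → ℂ} (hf : IsStandardSectionFamily 𝒦 χ f) {s₀ : ℂ} (h : ∀ k ∈ 𝒦.K, f s₀ k = 0) :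
    ∀ (s : ℂ) (x : HA L e dV hdV dW hdW), f s x = 0 :=
  eq_of_isStandardSectionFamily_of_eq_at 𝒦 hf (isStandardSectionFamily_zero 𝒦 χ) h

/-- **The same as an `iff` on the functions**: two standard families are EQUAL iff they agree on `𝒦.K` at some parameter. [cite: Tan1999, §1 p. 166] -/
theorem isStandardSectionFamily_ext_iff (𝒦 : IwasawaDatum L e dV hdV dW hdW) {χ : HeckeCharacter L}
    {f g : ℂ → HA L e dV hdV dW hdW → ℂ} (hf : IsStandardSectionFamily 𝒦 χ f) (hg : IsStandardSectionFamily 𝒦 χ g) (s₀ : ℂ) :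
    f = g ↔ ∀ k ∈ 𝒦.K, f s₀ k = g s₀ k :=
  ⟨fun hfg k _ => by rw [hfg], fun h => funext fun s => funext fun x => eq_of_isStandardSectionFamily_of_eq_at 𝒦 hf hg h s x⟩

end Summit.HodgeConjecture.HodgeConjecture.Cruxes.HLiu418.K2LiuStandardFamilyDeterminedAtPoint

end
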